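import Summits.QuantumFields.YangMills.Theorems.FluctuationComparisonRegPrIntLWindowExactnessOfGapOrbitThm1
import Summits.QuantumFields.YangMills.Theorems.UnitScaleTiltThm1GuardedFiveResidueThree
import HarnessLib

/-!
# S2β · ★★★★★ REGISTRY STUB 1 «EXW∘» `WindowExactness` FROM [Balaban1985Variational] THM 1 (8) ALONE, BY TOWER MONOTONICITY — clause (1) «the regular minimum
# over an interior datum is below the action of EVERY good history» is NOT an analytic letter; EXW∘ holds OUTRIGHT at every `L ≥ 5` and reduces to Thm 1 (8) at `L = 3`

Cell `ym3-torus` (YM ladder rung R3 = continuum `SU(2)` Yang–Mills on the three-torus at fixed lattice data — a RUNG: NOT d = 4, NOT infinite volume, NOT a mass gap,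
NOT Clay).  Width seat `ym3-torus-px13` (gen 21), FILE C; crux `stmt-QuantumFields-20520` (`…Theses.UnitScaleTilt.FluctuationComparisonRegPrIntL`), LINE g18-1 S2β,
registered organ stub `stub_windowExactness` (EXW∘, `Cruxes/FluctuationComparisonRegPrIntL/Lines/semiclassical_s2beta.lean` v11.4 :715, by-text docking);
`--kind proof --supports stmt-QuantumFields-20520 --as helper`, count-neutral, DEFINITION-FREE (0 `def`, 0 `instance`, 0 `notation`, 0 `sorry`, default heartbeats).

WHY.  EXW∘ has two clauses at every interior-window datum `V` (`PlaqSmall (θBal F.L γ (cw·b₀) p₀ J) V`) of every run `K ≥ J`: (1) `minActionRegPr F J K ε₀ V ≤ A(U)` for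
EVERY good history `U ∈ fibre_{J,K}(V) ∩ histGood(θBal b₀; K, J)`, and (2) a regular minimiser with a good history.  ✓p770212 (`…WindowExactnessOfGapOrbitThm1`) derived
(2) from the Thm-1 letter alone and (1) from the OTHER registered organ GAP♯∘; the cell's gap lists (UV3-NODE §37.3 ∕ §39.3 (iii) ∕ §47.3 (iii) ∕ §48.3 (iii)) carried (1)
as «REG-ARGMIN̄-type, analytic, unprinted at depth».  IT IS NOT: (1) follows from Thm 1 (8) in the tree's global reading (lit `Thm1GlobalMinAt`, a THEOREM at every
`L ≥ 5`: ✓`Thm1GuardedFiveResidueThree.thm1GlobalMinAt_five`) by MONOTONICITY OF THE REGULAR MINIMAL ENERGY ALONG THE AVERAGING TOWER.  Let `W_n := D_{n,K}U`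
(`J ≤ n ≤ K`; `W_J = V`, `W_K = U`) and `m_n := minActionRegPr F n K ε₀ W_n`.  (a) `m_{K−1} ≤ A(U)` (and `m_K ≤ A(U)`): `U` itself lies in print's space (6)(ε₀) one
level down, since its finest plaquettes are `< θBal(K) ≤ ε₀∕(4L³)` (lit ✓`regPr_of_plaqSmall`).  (b) `m_n ≤ m_{n+1}` (`J ≤ n`, `n + 1 < K`): the datum `W_{n+1}` is
`θBal(b₀)(n+1)`-small (good history, lit ✓`plaqSmall_fieldShift`), so Thm 1 (8) at `(n+1, K)` with `ε₁ := θBal(b₀)(n+1)` gives `U_{n+1} ∈ regFibrePr F (n+1) K (B₃ε₁) W_{n+1}`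
MINIMISING over `regFibrePr F (n+1) K ε₀ W_{n+1}` (`A(U_{n+1}) = m_{n+1}`); print's space (8) has ROOM for one more level — `B₃ε₁L³ ≤ ε₀` makes `RegPr F (n+1) K (B₃ε₁) ⊆
RegPr F n K ε₀` (`regPr_of_regPr_succ`: thresholds `e·L^{−2(K−n)}`, `e·L^{−3(K−n)}`) — and `D_{n,K}U_{n+1} = D_{n,n+1}W_{n+1} = W_n` (lit ✓`descendTo_descendTo`), so
`U_{n+1} ∈ regFibrePr F n K ε₀ W_n` and `m_n ≤ A(U_{n+1}) = m_{n+1}`.  Chain: `m_J ≤ … ≤ A(U)`.  The thresholds are EXW∘'s own (uniform): `θBal(b₀)(i) ≤ min a₁ (ε₀∕(2(4+B₃)L³))`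
for every `i` (lit ✓`exists_forall_θBal_le`), `ε₀ ≤ a₀`.  Print never states (1): its small-field region is a TUBE about the background tower ([Balaban1985UV3] (22), (47)),
inside which (1) is (142); the tree's `histGood` is the gauge-invariant plaquette history, and (1) for it is this nesting argument (cf. [Balaban1985UV3] p.266: the
`k`-th variational problem nests the previous ones; lit ✓`T3DescentFibreTower.minAction_tower`).

WHAT IS PROVED (sorry-free).
* §1 `plaqSmall_descendTo_of_histGood` (history levels as descended data), `regPr_of_regPr_succ` (one level of room in (2): `RegPr F (n+1) K e ⊆ RegPr F n K e′` for `e·L³ ≤ e′`).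
* §2 ★★★★ `minActionRegPr_le_action_of_histGood (hT : Thm1GlobalMinAt L a₀ a₁ B₃) … : minActionRegPr F J K hJK ε₀ V ≤ wilsonAction4 U` for every good history `U` over `V`
  (per member, thresholds `θ i ≤ a₁`, `B₃·θ i·L³ ≤ ε₀`, `4·θ i·L³ < ε₀`, `ε₀ ≤ a₀`) — the monotone chain, by induction on the depth; ★★★ `minActionRegPr_descend_mono` — one link, exported
  (`minActionRegPr F n K ε₀ (D_{n,K}U) ≤ minActionRegPr F (n+1) K ε₀ (D_{n+1,K}U)`, `J ≤ n`, `n + 1 < K`).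
* §3 `windowExactnessLower_at` ∕ `windowExactnessExists_at` ∕ ★★★★★`windowExactness_at (hT1 : Thm1GlobalMinAt L a₀ a₁ B₃) : ⟨EXW∘'s BODY at L⟩` (clause (2) = ✓p770212's §1–§2 per `L`);
  ★★★★★ `windowExactness_of_thm1 (hT : ∀ L, Odd L → 1 < L → ∃ a₀ a₁ B₃ > 0, Thm1GlobalMinAt L a₀ a₁ B₃) : ⟨registry `WindowExactness` TEXT VERBATIM⟩` — SUPERSEDES
  ✓`windowExactness_of_gapOrbit_thm1` (the GAP♯∘ hypothesis DELETED: EXW∘ is NOT downstream of GAP♯∘); ★★★★★ `windowExactness_of_thm1AtThree (hT₃ : ⟨Thm 1 (8) at L = 3⟩) :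
  ⟨EXW∘ TEXT⟩` — THE REGISTERED STUB REDUCED TO THM 1 (8) AT `L = 3` ALONE (✓`thm1_allL_of_three`); ★★★★★ `windowExactness_body_five (L) (h5 : 5 ≤ L) : ⟨EXW∘'s BODY at L⟩` —
  OUTRIGHT, ZERO HYPOTHESES, every `L ≥ 5`.

HONEST.  Composition BY NAME of landed theorems + elementary threshold arithmetic; the analytic content is the tree's (Thm 1 (8) global reading at `L ≥ 5` = the 19200
guarded chain ✓p790882 + ✓`stub_halvingStep`); nothing of Bałaban's analysis is added; the REGISTERED `stub_windowExactness` (every `L`, incl. `L = 3`), GAP♯∘ as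
registered, TUBE-REG∘'s uniform order, DET-REP-B, H4ᶜ∘, LFR♯ᶜ∘, S2β, crux 20520, 19936, 19200 and `YM3TorusSU2` are NOT proved; `L = 3` = EMBARGO-LITE №58; no summit
statement is proved by a helper; rung R3 = SU(2) YM₃ on T³ at fixed lattice data — NOT d = 4, NOT infinite volume, NOT a mass gap, NOT Clay; the Yang–Mills mass gap is
NOT proved.  Axioms standard.

References: T. Bałaban, CMP **102** (1985) 277–309 [Balaban1985Variational] ((2)–(8) p.278, Thm 1 (8) p.279, Prop. 7 p.299, Prop. 8 p.304); CMP **102** (1985) 255–275 [Balaban1985UV3]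
((7) p.257, (22) p.261, (41)–(42) p.266, (47) p.267); CMP **109** (1987) [Balaban1987RG1] ((0.11) p.253); CMP **98** (1985) [Balaban1985Averaging] (Prop. 2 (52)–(54) p.26).
-/

set_option autoImplicit false

noncomputable section

namespace Summit.QuantumFields.YangMills.Theorems.FluctuationComparisonRegPrIntLS2BetaWindowExactnessOfTower

open Literature.MathematicalPhysics.QuantumFieldTheory.Balaban1983to89
open Literature.MathematicalPhysics.QuantumFieldTheory.Balaban1983to89.T3ContinuumYM3Torus
open Literature.MathematicalPhysics.QuantumFieldTheory.Balaban1983to89.T3UnitLawDensityEML (ℰp)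
open Literature.MathematicalPhysics.QuantumFieldTheory.Balaban1983to89.T3UnitScaleTilt
open Literature.MathematicalPhysics.QuantumFieldTheory.Balaban1983to89.T3TiltDescent
open Literature.MathematicalPhysics.QuantumFieldTheory.Balaban1983to89.T3CruxEstimates (plaqSmall_fieldShift)
open Literature.MathematicalPhysics.QuantumFieldTheory.Balaban1983to89.T3ConstrainedMinimiser (fibre)
open Literature.MathematicalPhysics.QuantumFieldTheory.Balaban1983to89.T3DescentFibreTower
open Literature.MathematicalPhysics.QuantumFieldTheory.Balaban1983to89.T3RegularMinimiser
open Literature.MathematicalPhysics.QuantumFieldTheory.Balaban1983to89.T3PrintedRegularMinimiser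
open Literature.MathematicalPhysics.QuantumFieldTheory.Balaban1983to89.T3PrintedMinimiserExistence
open Literature.MathematicalPhysics.QuantumFieldTheory.Balaban1983to89.T3MinimiserStabilityReduction (θBal_pos)
open Literature.MathematicalPhysics.QuantumFieldTheory.Balaban1983to89.T3ThresholdSmallness (exists_forall_θBal_le)
open Literature.MathematicalPhysics.QuantumFieldTheory.Balaban1983to89.T3InteriorExcision (θBal_mul θBal_mul_le histGood_mono_profile)
open Literature.MathematicalPhysics.QuantumFieldTheory.Balaban1983to89.T3AvgDivergenceSplit (regPr_of_plaqSmall)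
open Literature.MathematicalPhysics.QuantumFieldTheory.Balaban1983to89.T4Continuum
open Summit.QuantumFields.YangMills.Theorems.FluctuationComparisonRegPrIntLWindowExactnessOfGapOrbitThm1 (windowExactnessExists_of_thm1
  chiGood_interior_of_thm1GlobalMinAt exists_regMin_histGood_self histGood_of_chiGood_witness two_le_L_mul_sqrt)
open Summit.QuantumFields.YangMills.Theorems.Thm1GuardedFiveResidueThree (thm1GlobalMinAt_five five_le_of_odd_of_ne_three thm1_allL_of_three)

/-! ## §1 Tower bookkeeping: history levels as descended data; one level of room in print's regular class (2) -/

section Tower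

variable (F : T3Family)

/-- **HISTORY LEVELS AS DESCENDED DATA**: a good history `U ∈ histGood(θ; K, J)` has a `θ(n)`-small descended field `D_{n,K}U` at every height `J ≤ n ≤ K` (the history's
`(K−n)`-fold average read on the `n`-th tower, lit ✓`plaqSmall_fieldShift`). [cite: Balaban1985UV3, (7) p.257; Balaban1987RG1, (0.11) p.253] -/
theorem plaqSmall_descendTo_of_histGood {θ : ℕ → ℝ} {J K : ℕ} {U : GaugeField (F.P K) 0 (Matrix.specialUnitaryGroup (Fin 2) ℂ)}
    (hU : U ∈ histGood F ℰp θ K J) {n : ℕ} (hJn : J ≤ n) (hnK : n ≤ K) :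
    PlaqSmall (θ n) (descendTo F ℰp n K hnK U) := by
  have h := hU (K - n) (by omega)
  rw [show K - (K - n) = n by omega] at h
  exact (plaqSmall_fieldShift F _ (θ n) _).mpr h

/-- **ONE LEVEL OF ROOM IN PRINT'S REGULAR CLASS (2)**: `RegPr F (n+1) K e U` (thresholds `e·L^{−2(K−n−1)}`, `e·L^{−3(K−n−1)}`) implies `RegPr F n K e′ U` one level deeper as soon as
`e·L³ ≤ e′` — the room between (8) (`e = B₃ε₁`) and (6) (`e′ = ε₀`). [cite: Balaban1985Variational, (2) p.278, (6)-(8) pp.278-279; Balaban1985RegularSpaces, (1.7)-(1.9) p.77] -/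
theorem regPr_of_regPr_succ {n K : ℕ} (hn : n + 1 ≤ K) {e e' : ℝ} (he : 0 ≤ e) (hee : e * (F.L : ℝ) ^ 3 ≤ e')
    {U : GaugeField (F.P K) 0 (Matrix.specialUnitaryGroup (Fin 2) ℂ)} (hU : RegPr F (n + 1) K e U) : RegPr F n K e' U := by
  have hL1 : (1 : ℝ) ≤ (F.L : ℝ) := by have := F.hL.2; exact_mod_cast (by omega : 1 ≤ F.L)
  have hL0 : (0 : ℝ) < (F.L : ℝ) := by linarith
  have hLi : (0 : ℝ) < (F.L : ℝ)⁻¹ := inv_pos.mpr hL0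
  have hK : K - n = (K - (n + 1)) + 1 := by omega
  -- `e·L² ≤ e·L³ ≤ e'`
  have he2 : e * (F.L : ℝ) ^ 2 ≤ e' := by
    have : (F.L : ℝ) ^ 2 ≤ (F.L : ℝ) ^ 3 := pow_le_pow_right₀ hL1 (by norm_num)
    nlinarith
  refine ⟨fun p => (hU.1 p).trans_le ?_, fun b => (hU.2 b).trans_le ?_⟩
  · -- plaquette thresholds: `e·(L⁻¹)^{2(K−n−1)} ≤ e'·(L⁻¹)^{2(K−n)}`
    show e * ((F.L : ℝ)⁻¹) ^ (2 * (K - (n + 1))) ≤ e' * ((F.L : ℝ)⁻¹) ^ (2 * (K - n))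
    rw [hK, show 2 * (K - (n + 1) + 1) = 2 * (K - (n + 1)) + 2 by ring, pow_add]
    have hsq : ((F.L : ℝ)⁻¹) ^ 2 * (F.L : ℝ) ^ 2 = 1 := by rw [← mul_pow, inv_mul_cancel₀ hL0.ne', one_pow]
    have hpos : (0 : ℝ) ≤ ((F.L : ℝ)⁻¹) ^ (2 * (K - (n + 1))) := by positivity
    calc e * ((F.L : ℝ)⁻¹) ^ (2 * (K - (n + 1)))
        = (e * (F.L : ℝ) ^ 2) * (((F.L : ℝ)⁻¹) ^ (2 * (K - (n + 1))) * ((F.L : ℝ)⁻¹) ^ 2) := by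
          rw [mul_comm (((F.L : ℝ)⁻¹) ^ (2 * (K - (n + 1)))), ← mul_assoc, mul_assoc e, mul_comm ((F.L : ℝ) ^ 2), hsq, mul_one]
      _ ≤ e' * (((F.L : ℝ)⁻¹) ^ (2 * (K - (n + 1))) * ((F.L : ℝ)⁻¹) ^ 2) :=
          mul_le_mul_of_nonneg_right he2 (by positivity)
  · -- divergence thresholds: `e·(L⁻¹)^{3(K−n−1)} ≤ e'·(L⁻¹)^{3(K−n)}`
    rw [hK, show 3 * (K - (n + 1) + 1) = 3 * (K - (n + 1)) + 3 by ring, pow_add]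
    have hcu : ((F.L : ℝ)⁻¹) ^ 3 * (F.L : ℝ) ^ 3 = 1 := by rw [← mul_pow, inv_mul_cancel₀ hL0.ne', one_pow]
    calc e * ((F.L : ℝ)⁻¹) ^ (3 * (K - (n + 1)))
        = (e * (F.L : ℝ) ^ 3) * (((F.L : ℝ)⁻¹) ^ (3 * (K - (n + 1))) * ((F.L : ℝ)⁻¹) ^ 3) := by
          rw [mul_comm (((F.L : ℝ)⁻¹) ^ (3 * (K - (n + 1)))), ← mul_assoc, mul_assoc e, mul_comm ((F.L : ℝ) ^ 3), hcu, mul_one]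
      _ ≤ e' * (((F.L : ℝ)⁻¹) ^ (3 * (K - (n + 1))) * ((F.L : ℝ)⁻¹) ^ 3) :=
          mul_le_mul_of_nonneg_right hee (by positivity)

end Tower

/-! ## §2 THE MONOTONE CHAIN: the regular minimal energy does not increase under averaging of the data (Thm 1 (8)'s room), hence clause (1) -/

section Chain

variable {F : T3Family}

/-- ★★★★ **THE MONOTONE CHAIN — EXW∘'s CLAUSE (1) FROM THM 1 (8) AT ONE BLOCK SIZE.**  Given [Balaban1985Variational] Thm 1 (8) in the global reading at `L`
(`Thm1GlobalMinAt L a₀ a₁ B₃`), a member `F` (`F.L = L`), `ε₀ ≤ a₀`, and a history profile `θ` with `0 < θ i ≤ a₁`, `B₃·θ i·L³ ≤ ε₀`, `4·θ i·L³ < ε₀`: for EVERY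
`U ∈ fibre_{J,K}(V) ∩ histGood(θ; K, J)`, `minActionRegPr F J K ε₀ V ≤ A(U)`.  Induction on the depth `d = K − n` of `m_n := minActionRegPr F n K ε₀ (D_{n,K}U) ≤ A(U)`:
`d ≤ 1` by `U` itself (lit ✓`regPr_of_plaqSmall`); `d + 1 ≥ 2`: Thm 1's minimiser `U_{n+1} ∈ (8)` for the `θ(n+1)`-small datum `D_{n+1,K}U` realises `m_{n+1}`
(lit ✓`minActionRegPr_eq_of_isMinOn`), lies in (6)(ε₀) one level down (`regPr_of_regPr_succ`) over `D_{n,K}U` (lit ✓`descendTo_descendTo`), so `m_n ≤ A(U_{n+1}) = m_{n+1}`.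
[cite: Balaban1985Variational, Thm 1 (8) p.279, (6)-(8) pp.278-279; Balaban1985UV3, (41)-(42) p.266; Balaban1987RG1, (0.11) p.253] -/
theorem minActionRegPr_le_action_of_histGood {L : ℕ} {a₀ a₁ B₃ : ℝ} (hT : Thm1GlobalMinAt L a₀ a₁ B₃) (hB₃ : 0 < B₃)
    (hFL : F.L = L) {ε₀ : ℝ} (hε₀a : ε₀ ≤ a₀) {θ : ℕ → ℝ} (hθpos : ∀ i, 0 < θ i)
    (hθa : ∀ i, θ i ≤ a₁) (hθB : ∀ i, B₃ * θ i * (F.L : ℝ) ^ 3 ≤ ε₀) (hθ4 : ∀ i, 4 * θ i * (F.L : ℝ) ^ 3 < ε₀)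
    {J K : ℕ} (hJK : J ≤ K) {V : GaugeField (F.P J) 0 (Matrix.specialUnitaryGroup (Fin 2) ℂ)}
    {U : GaugeField (F.P K) 0 (Matrix.specialUnitaryGroup (Fin 2) ℂ)} (hUf : U ∈ fibre F ℰp J K hJK V) (hUg : U ∈ histGood F ℰp θ K J) :
    minActionRegPr F J K hJK ε₀ V ≤ wilsonAction4 U := by
  have hL1 : (1 : ℝ) ≤ (F.L : ℝ) := by have := F.hL.2; exact_mod_cast (by omega : 1 ≤ F.L)
  have hL0 : (0 : ℝ) < (F.L : ℝ) := by linarith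
  have hL3 : (1 : ℝ) ≤ (F.L : ℝ) ^ 3 := one_le_pow₀ hL1
  -- `B₃θ ≤ ε₀`, `θL² ≤ θL³`, `4θL³ < ε₀`
  have hBθ : ∀ i, B₃ * θ i ≤ ε₀ := fun i => by
    have h1 : B₃ * θ i * 1 ≤ B₃ * θ i * (F.L : ℝ) ^ 3 := mul_le_mul_of_nonneg_left hL3 (mul_pos hB₃ (hθpos i)).le
    linarith [hθB i]
  -- the chain, by induction on the depth `d = K − n`
  suffices hmain : ∀ (d n : ℕ) (hnK : n ≤ K), K - n = d → J ≤ n →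
      minActionRegPr F n K hnK ε₀ (descendTo F ℰp n K hnK U) ≤ wilsonAction4 U by
    have h := hmain (K - J) J hJK rfl le_rfl
    rwa [(mem_fibre_iff F ℰp).mp hUf] at h
  intro d
  induction d with
  | zero =>
    intro n hnK hd hJn
    have hn : n = K := by omega
    subst hn
    -- depth 0: `U` itself, in (6)(ε₀) at the trivial thresholds
    have hpl : PlaqSmall (θ n) U := by
      have h := plaqSmall_descendTo_of_histGood F hUg hJn le_rfl
      rwa [descendTo_self] at h
    have hreg : RegPr F n n ε₀ U := by
      refine regPr_of_plaqSmall F hpl ?_ ?_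
      · show θ n ≤ ε₀ * ((F.L : ℝ)⁻¹) ^ (2 * (n - n))
        rw [Nat.sub_self, mul_zero, pow_zero, mul_one]
        nlinarith [hθ4 n, hθpos n]
      · rw [Nat.sub_self, mul_zero, pow_zero, mul_one]
        nlinarith [hθ4 n, hθpos n]
    have hmem : U ∈ regFibrePr F n n hnK ε₀ (descendTo F ℰp n n hnK U) :=
      (mem_regFibrePr_iff F).mpr ⟨(mem_fibre_iff F ℰp).mpr rfl, hreg⟩
    exact minActionRegPr_le F hmem
  | succ d ih =>
    intro n hnK hd hJn
    have hn1 : n + 1 ≤ K := by omega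
    rcases Nat.eq_zero_or_pos d with hd0 | hdpos
    · -- depth 1: `U` itself is in (6)(ε₀) one level down
      subst hd0
      have hK : K = n + 1 := by omega
      subst hK
      have hpl : PlaqSmall (θ (n + 1)) U := by
        have h := plaqSmall_descendTo_of_histGood F hUg (by omega : J ≤ n + 1) le_rfl
        rwa [descendTo_self] at h
      have hreg : RegPr F n (n + 1) ε₀ U := by
        refine regPr_of_plaqSmall F hpl ?_ ?_
        · show θ (n + 1) ≤ ε₀ * ((F.L : ℝ)⁻¹) ^ (2 * (n + 1 - n))
          rw [show n + 1 - n = 1 by omega, mul_one, inv_pow, ← div_eq_mul_inv, le_div_iff₀ (pow_pos hL0 2)]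
          have : (F.L : ℝ) ^ 2 ≤ (F.L : ℝ) ^ 3 := pow_le_pow_right₀ hL1 (by norm_num)
          nlinarith [hθ4 (n + 1), hθpos (n + 1)]
        · rw [show n + 1 - n = 1 by omega, mul_one, inv_pow, ← div_eq_mul_inv, lt_div_iff₀ (pow_pos hL0 3)]
          linarith [hθ4 (n + 1)]
      have hmem : U ∈ regFibrePr F n (n + 1) hnK ε₀ (descendTo F ℰp n (n + 1) hnK U) :=
        (mem_regFibrePr_iff F).mpr ⟨(mem_fibre_iff F ℰp).mpr rfl, hreg⟩
      exact minActionRegPr_le F hmem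
    · -- depth `d + 1 ≥ 2`: Thm 1's minimiser for the datum one level up descends with room
      have hlt : n + 1 < K := by omega
      set W' := descendTo F ℰp (n + 1) K hn1 U with hW'
      have hW'small : PlaqSmall (θ (n + 1)) W' := plaqSmall_descendTo_of_histGood F hUg (by omega) hn1
      obtain ⟨U', hU'8, hmin⟩ := hT F hFL (n + 1) K hlt (θ (n + 1)) ε₀ (hθpos _) (hθa _) (hBθ _) hε₀a W' hW'small
      have hU'6 : U' ∈ regFibrePr F (n + 1) K hlt.le ε₀ W' := regFibrePr_mono F (hBθ _) W' hU'8
      have hA' : wilsonAction4 U' = minActionRegPr F (n + 1) K hlt.le ε₀ W' := minActionRegPr_eq_of_isMinOn F hU'6 hmin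
      have hIH : minActionRegPr F (n + 1) K hn1 ε₀ W' ≤ wilsonAction4 U := ih (n + 1) hn1 (by omega) (by omega)
      -- `U'` over the datum one level down, in (6)(ε₀) there
      have hU'fib : U' ∈ fibre F ℰp n K hnK (descendTo F ℰp n K hnK U) := by
        rw [mem_fibre_iff, ← descendTo_descendTo F ℰp (Nat.le_succ n) hn1, ((mem_regFibrePr_iff F).mp hU'8).1, hW',
          descendTo_descendTo]
      have hU'reg : RegPr F n K ε₀ U' :=
        regPr_of_regPr_succ F hn1 (mul_pos hB₃ (hθpos _)).le (hθB _) ((mem_regFibrePr_iff F).mp hU'8).2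
      have hmem : U' ∈ regFibrePr F n K hnK ε₀ (descendTo F ℰp n K hnK U) := (mem_regFibrePr_iff F).mpr ⟨hU'fib, hU'reg⟩
      calc minActionRegPr F n K hnK ε₀ (descendTo F ℰp n K hnK U) ≤ wilsonAction4 U' := minActionRegPr_le F hmem
        _ = minActionRegPr F (n + 1) K hlt.le ε₀ W' := hA'
        _ ≤ wilsonAction4 U := hIH

/-- ★★★ **ONE LINK OF THE CHAIN, EXPORTED**: for a good history `U` over its own descended data, the regular minimal energy does not increase when the datum is
averaged once — `minActionRegPr F n K ε₀ (D_{n,K}U) ≤ minActionRegPr F (n+1) K ε₀ (D_{n+1,K}U)` for `J ≤ n`, `n + 1 < K` (Thm 1's (8)-minimiser for `D_{n+1,K}U` realises the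
right side and is admissible on the left, `regPr_of_regPr_succ` + lit ✓`descendTo_descendTo`). [cite: Balaban1985Variational, Thm 1 (8) p.279, (6)-(8) pp.278-279; Balaban1985UV3, (41)-(42) p.266] -/
theorem minActionRegPr_descend_mono {L : ℕ} {a₀ a₁ B₃ : ℝ} (hT : Thm1GlobalMinAt L a₀ a₁ B₃) (hB₃ : 0 < B₃)
    (hFL : F.L = L) {ε₀ : ℝ} (hε₀a : ε₀ ≤ a₀) {θ : ℕ → ℝ} (hθpos : ∀ i, 0 < θ i)
    (hθa : ∀ i, θ i ≤ a₁) (hθB : ∀ i, B₃ * θ i * (F.L : ℝ) ^ 3 ≤ ε₀)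
    {J K : ℕ} {U : GaugeField (F.P K) 0 (Matrix.specialUnitaryGroup (Fin 2) ℂ)} (hUg : U ∈ histGood F ℰp θ K J)
    {n : ℕ} (hJn : J ≤ n) (hn1 : n + 1 < K) :
    minActionRegPr F n K (by omega) ε₀ (descendTo F ℰp n K (by omega) U) ≤
      minActionRegPr F (n + 1) K hn1.le ε₀ (descendTo F ℰp (n + 1) K hn1.le U) := by
  have hL1 : (1 : ℝ) ≤ (F.L : ℝ) := by have := F.hL.2; exact_mod_cast (by omega : 1 ≤ F.L)
  have hL3 : (1 : ℝ) ≤ (F.L : ℝ) ^ 3 := one_le_pow₀ hL1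
  have hBθ : B₃ * θ (n + 1) ≤ ε₀ := by
    have h1 : B₃ * θ (n + 1) * 1 ≤ B₃ * θ (n + 1) * (F.L : ℝ) ^ 3 := mul_le_mul_of_nonneg_left hL3 (mul_pos hB₃ (hθpos _)).le
    linarith [hθB (n + 1)]
  have hW'small : PlaqSmall (θ (n + 1)) (descendTo F ℰp (n + 1) K hn1.le U) := plaqSmall_descendTo_of_histGood F hUg (by omega) hn1.le
  obtain ⟨U', hU'8, hmin⟩ := hT F hFL (n + 1) K hn1 (θ (n + 1)) ε₀ (hθpos _) (hθa _) hBθ hε₀a _ hW'small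
  have hU'6 : U' ∈ regFibrePr F (n + 1) K hn1.le ε₀ (descendTo F ℰp (n + 1) K hn1.le U) := regFibrePr_mono F hBθ _ hU'8
  have hA' : wilsonAction4 U' = minActionRegPr F (n + 1) K hn1.le ε₀ (descendTo F ℰp (n + 1) K hn1.le U) := minActionRegPr_eq_of_isMinOn F hU'6 hmin
  have hU'fib : U' ∈ fibre F ℰp n K (by omega) (descendTo F ℰp n K (by omega) U) := by
    rw [mem_fibre_iff, ← descendTo_descendTo F ℰp (Nat.le_succ n) hn1.le, ((mem_regFibrePr_iff F).mp hU'8).1, descendTo_descendTo]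
  have hU'reg : RegPr F n K ε₀ U' := regPr_of_regPr_succ F hn1.le (mul_pos hB₃ (hθpos _)).le (hθB _) ((mem_regFibrePr_iff F).mp hU'8).2
  rw [← hA']
  exact minActionRegPr_le F ((mem_regFibrePr_iff F).mpr ⟨hU'fib, hU'reg⟩)

end Chain

/-! ## §3 EXW∘ — THE REGISTRY TEXT OF `WindowExactness` FROM THE THM-1 LETTER ALONE; at every `L ≥ 5` outright; from its `L = 3` instance -/

section Door

/-- ★★★★ **EXW∘'s CLAUSE (1) AT ONE BLOCK SIZE, IN THE REGISTRY'S QUANTIFIER PREFIX, FROM THM 1 (8) AT THAT BLOCK SIZE** (`c₀ := 1`, `pS := 0`, `ε₁ := a₀`, `γ₁` from lit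
✓`exists_forall_θBal_le` so that `θBal(b₀)(i) ≤ min a₁ (ε₀∕(2(4+B₃)L³))` at every `i`; §2 with `θ := θBal F.L γ b₀ p₀`). [cite: Balaban1985Variational, Thm 1 (8) p.279; Balaban1985UV3, (7) p.257, (41) p.266] -/
theorem windowExactnessLower_at {L : ℕ} (hL1 : 1 < L) {a₀ a₁ B₃ : ℝ} (ha₀ : 0 < a₀) (ha₁ : 0 < a₁) (hB₃ : 0 < B₃)
    (hT1 : Thm1GlobalMinAt L a₀ a₁ B₃) :
    ∃ c₀ : ℝ, 0 < c₀ ∧ c₀ ≤ 1 ∧ ∀ (cw : ℝ), 0 < cw → cw ≤ c₀ → ∃ pS : ℝ, ∀ (b₀ p₀ : ℝ), 0 < b₀ → pS ≤ p₀ → 0 < p₀ →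
      ∃ ε₁ : ℝ, 0 < ε₁ ∧ ∀ (ε₀ : ℝ), 0 < ε₀ → ε₀ ≤ ε₁ →
      ∃ γ₁ : ℝ, 0 < γ₁ ∧ ∀ (F : T3Family) (γ : ℝ), F.L = L → 0 < γ → γ ≤ γ₁ →
        ∀ (J K : ℕ) (hJK : J ≤ K) (V : GaugeField (F.P J) 0 (Matrix.specialUnitaryGroup (Fin 2) ℂ)), PlaqSmall (θBal F.L γ (cw * b₀) p₀ J) V →
          ∀ U ∈ fibre F ℰp J K hJK V, U ∈ histGood F ℰp (θBal F.L γ b₀ p₀) K J →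
            minActionRegPr F J K hJK ε₀ V ≤ wilsonAction4 U := by
  have hL : 1 ≤ L := hL1.le
  have hL0 : (0 : ℝ) < (L : ℝ) := by exact_mod_cast (show 0 < L by omega)
  refine ⟨1, one_pos, le_rfl, fun cw hcw0 hcw1 => ⟨0, fun b₀ p₀ hb _ hp => ⟨a₀, ha₀, fun ε₀ hε₀ hε₀a => ?_⟩⟩⟩
  -- the uniform history threshold: `θBal(b₀)(i) ≤ min a₁ (ε₀ ∕ (2(4+B₃)L³))` for every `i`
  set c : ℝ := 2 * (4 + B₃) * (L : ℝ) ^ 3 with hc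
  have hcpos : 0 < c := by positivity
  obtain ⟨γθ, hγθ, Hθ⟩ := exists_forall_θBal_le hL b₀ p₀ (lt_min ha₁ (div_pos hε₀ hcpos))
  refine ⟨min γθ 1, lt_min hγθ one_pos, fun F γ hFL hγ hγle J K hJK V _ U hUf hUg => ?_⟩
  have hγθ' : γ ≤ γθ := hγle.trans (min_le_left _ _)
  have hγ1 : γ ≤ 1 := hγle.trans (min_le_right _ _)
  have hθle : ∀ i, θBal F.L γ b₀ p₀ i ≤ min a₁ (ε₀ / c) := fun i => by rw [hFL]; exact Hθ γ hγ hγθ' i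
  have hθpos : ∀ i, 0 < θBal F.L γ b₀ p₀ i := fun i => θBal_pos F.hL.2.le hγ hγ1 hb p₀ i
  have hθc : ∀ i, θBal F.L γ b₀ p₀ i * c ≤ ε₀ := fun i => by
    have h := (hθle i).trans (min_le_right _ _)
    rwa [le_div_iff₀ hcpos] at h
  have hFL3 : (F.L : ℝ) ^ 3 = (L : ℝ) ^ 3 := by rw [hFL]
  refine minActionRegPr_le_action_of_histGood (F := F) hT1 hB₃ hFL hε₀a hθpos (fun i => (hθle i).trans (min_le_left _ _))
    (fun i => ?_) (fun i => ?_) hJK hUf hUg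
  · -- `B₃·θ·L³ ≤ θ·c ≤ ε₀`
    have h1 : B₃ * (F.L : ℝ) ^ 3 ≤ c := by rw [hFL3, hc]; nlinarith [pow_pos hL0 3]
    calc B₃ * θBal F.L γ b₀ p₀ i * (F.L : ℝ) ^ 3 = θBal F.L γ b₀ p₀ i * (B₃ * (F.L : ℝ) ^ 3) := by ring
      _ ≤ θBal F.L γ b₀ p₀ i * c := mul_le_mul_of_nonneg_left h1 (hθpos i).le
      _ ≤ ε₀ := hθc i
  · -- `4·θ·L³ < θ·c ≤ ε₀`
    have h1 : 4 * (F.L : ℝ) ^ 3 < c := by rw [hFL3, hc]; nlinarith [pow_pos hL0 3]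
    calc 4 * θBal F.L γ b₀ p₀ i * (F.L : ℝ) ^ 3 = θBal F.L γ b₀ p₀ i * (4 * (F.L : ℝ) ^ 3) := by ring
      _ < θBal F.L γ b₀ p₀ i * c := mul_lt_mul_of_pos_left h1 (hθpos i)
      _ ≤ ε₀ := hθc i

/-- ★★ **EXW∘'s CLAUSE (2) AT ONE BLOCK SIZE FROM THM 1 (8) AT THAT BLOCK SIZE** — ✓p770212's `windowExactnessExists_of_thm1` run at one `L` (its per-`L` pieces
✓`chiGood_interior_of_thm1GlobalMinAt` ∕ ✓`histGood_of_chiGood_witness` ∕ ✓`exists_regMin_histGood_self`, VERBATIM). [cite: Balaban1985Variational, Thm 1 (8) p.279; Balaban1985Averaging, Prop. 2 (53) p.26] -/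
theorem windowExactnessExists_at {L : ℕ} (hL1 : 1 < L) {a₀ a₁ B₃ : ℝ} (ha₀ : 0 < a₀) (ha₁ : 0 < a₁) (hB₃ : 0 < B₃)
    (hT1 : Thm1GlobalMinAt L a₀ a₁ B₃) :
    ∃ c₀ : ℝ, 0 < c₀ ∧ c₀ ≤ 1 ∧ ∀ (cw : ℝ), 0 < cw → cw ≤ c₀ → ∃ pS : ℝ, ∀ (b₀ p₀ : ℝ), 0 < b₀ → pS ≤ p₀ → 0 < p₀ →
      ∃ ε₁ : ℝ, 0 < ε₁ ∧ ∀ (ε₀ : ℝ), 0 < ε₀ → ε₀ ≤ ε₁ →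
      ∃ γ₁ : ℝ, 0 < γ₁ ∧ ∀ (F : T3Family) (γ : ℝ), F.L = L → 0 < γ → γ ≤ γ₁ →
        ∀ (J K : ℕ) (hJK : J ≤ K) (V : GaugeField (F.P J) 0 (Matrix.specialUnitaryGroup (Fin 2) ℂ)), PlaqSmall (θBal F.L γ (cw * b₀) p₀ J) V →
          ∃ U₀ ∈ regFibrePr F J K hJK ε₀ V, U₀ ∈ histGood F ℰp (θBal F.L γ b₀ p₀) K J ∧
            wilsonAction4 U₀ = minActionRegPr F J K hJK ε₀ V := by
  have hL : 1 ≤ L := hL1.le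
  refine ⟨min 1 B₃⁻¹, lt_min one_pos (inv_pos.mpr hB₃), min_le_left _ _, fun cw hcw0 hcwle => ?_⟩
  have hcw1 : cw ≤ 1 := hcwle.trans (min_le_left _ _)
  have hcB : B₃ * cw ≤ 1 := by
    have h := mul_le_mul_of_nonneg_left (hcwle.trans (min_le_right _ _)) hB₃.le
    rwa [mul_inv_cancel₀ hB₃.ne'] at h
  refine ⟨0, fun b₀ p₀ hb _ hp => ⟨a₀, ha₀, fun ε₀ hε₀ hε₀a => ?_⟩⟩
  obtain ⟨γE, hγE, hγE1, HE⟩ :=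
    chiGood_interior_of_thm1GlobalMinAt (b₀ := b₀) (p₀ := p₀) hL hT1 ha₁ hB₃ hb hp.le hε₀ hε₀a hcw0 hcB
  obtain ⟨γc, hγc, Hc⟩ := exists_forall_θBal_le hL (cw * b₀) p₀ (show (0 : ℝ) < ε₀ / 8 by positivity)
  refine ⟨min γE γc, lt_min hγE hγc, fun F γ hFL hγ hγle J K hJK V hV => ?_⟩
  have hγE' : γ ≤ γE := hγle.trans (min_le_left _ _)
  have hγ1 : γ ≤ 1 := hγE'.trans hγE1
  rcases Nat.eq_or_lt_of_le hJK with hEq | hlt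
  · subst hEq
    have hθε : 4 * θBal F.L γ (cw * b₀) p₀ J < ε₀ := by
      have h := Hc γ hγ (hγle.trans (min_le_right _ _)) J
      rw [hFL]
      linarith
    exact exists_regMin_histGood_self hγ hγ1 hb hcw0 hcw1 J hθε hV
  · obtain ⟨U, hUreg, hUmin, hUhist⟩ := HE F γ hFL hγ hγE' hlt V hV
    have hμ : (0 : ℝ) ≤ 1 - 2 / ((F.L : ℝ) * Real.sqrt F.L) := by
      have h2 := two_le_L_mul_sqrt F
      have hpos : (0 : ℝ) < (F.L : ℝ) * Real.sqrt F.L := by linarith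
      rw [sub_nonneg, div_le_one hpos]
      exact h2
    have hVb : PlaqSmall (θBal F.L γ b₀ p₀ J) V :=
      fun p => (hV p).trans_le (θBal_mul_le F.hL.2.le hγ hγ1 hb hcw1 p₀ J)
    exact ⟨U, hUreg, histGood_of_chiGood_witness hμ hγ hγ1 hb hJK hVb ((mem_regFibrePr_iff F).mp hUreg).1 hUhist, hUmin⟩

/-- ★★★★★ **EXW∘'s BODY AT ONE BLOCK SIZE FROM THM 1 (8) AT THAT BLOCK SIZE** — both clauses (thresholds `min`∕`max`). [cite: Balaban1985Variational, Thm 1 (8) p.279; Balaban1985UV3, (41) p.266] -/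
theorem windowExactness_at {L : ℕ} (hL1 : 1 < L) {a₀ a₁ B₃ : ℝ} (ha₀ : 0 < a₀) (ha₁ : 0 < a₁) (hB₃ : 0 < B₃)
    (hT1 : Thm1GlobalMinAt L a₀ a₁ B₃) :
    ∃ c₀ : ℝ, 0 < c₀ ∧ c₀ ≤ 1 ∧ ∀ (cw : ℝ), 0 < cw → cw ≤ c₀ → ∃ pS : ℝ, ∀ (b₀ p₀ : ℝ), 0 < b₀ → pS ≤ p₀ → 0 < p₀ → ∃ ε₁ : ℝ, 0 < ε₁ ∧ ∀ (ε₀ : ℝ), 0 < ε₀ → ε₀ ≤ ε₁ →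
    ∃ γ₁ : ℝ, 0 < γ₁ ∧ ∀ (F : T3Family) (γ : ℝ), F.L = L → 0 < γ → γ ≤ γ₁ →
      ∀ (J K : ℕ) (hJK : J ≤ K) (V : GaugeField (F.P J) 0 (Matrix.specialUnitaryGroup (Fin 2) ℂ)), PlaqSmall (θBal F.L γ (cw * b₀) p₀ J) V →
        (∀ U ∈ fibre F ℰp J K hJK V, U ∈ histGood F ℰp (θBal F.L γ b₀ p₀) K J →
            minActionRegPr F J K hJK ε₀ V ≤ wilsonAction4 U) ∧
        (∃ U₀ ∈ regFibrePr F J K hJK ε₀ V, U₀ ∈ histGood F ℰp (θBal F.L γ b₀ p₀) K J ∧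
            wilsonAction4 U₀ = minActionRegPr F J K hJK ε₀ V) := by
  obtain ⟨c₂, hc₂, -, h₂⟩ := windowExactnessLower_at hL1 ha₀ ha₁ hB₃ hT1
  obtain ⟨c₁, hc₁, hc₁1, h₁⟩ := windowExactnessExists_at hL1 ha₀ ha₁ hB₃ hT1
  refine ⟨min c₁ c₂, lt_min hc₁ hc₂, (min_le_left _ _).trans hc₁1, fun cw hcw0 hcwle => ?_⟩
  obtain ⟨pS₁, h₁'⟩ := h₁ cw hcw0 (hcwle.trans (min_le_left _ _))
  obtain ⟨pS₂, h₂'⟩ := h₂ cw hcw0 (hcwle.trans (min_le_right _ _))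
  refine ⟨max pS₁ pS₂, fun b₀ p₀ hb hpS hp => ?_⟩
  obtain ⟨ε₁, hε₁, h₁''⟩ := h₁' b₀ p₀ hb ((le_max_left _ _).trans hpS) hp
  obtain ⟨ε₂, hε₂, h₂''⟩ := h₂' b₀ p₀ hb ((le_max_right _ _).trans hpS) hp
  refine ⟨min ε₁ ε₂, lt_min hε₁ hε₂, fun ε₀ hε₀ hε₀le => ?_⟩
  obtain ⟨γ₁, hγ₁, H₁⟩ := h₁'' ε₀ hε₀ (hε₀le.trans (min_le_left _ _))
  obtain ⟨γ₂, hγ₂, H₂⟩ := h₂'' ε₀ hε₀ (hε₀le.trans (min_le_right _ _))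
  refine ⟨min γ₁ γ₂, lt_min hγ₁ hγ₂, fun F γ hFL hγ hγle J K hJK V hV => ?_⟩
  obtain ⟨U₀, hU₀reg, hU₀good, hU₀min⟩ := H₁ F γ hFL hγ (hγle.trans (min_le_left _ _)) J K hJK V hV
  exact ⟨fun U hU hUg => H₂ F γ hFL hγ (hγle.trans (min_le_right _ _)) J K hJK V hV U hU hUg, U₀, hU₀reg, hU₀good, hU₀min⟩

/-- ★★★★★ **REGISTRY STUB 1 EXW∘ `WindowExactness` (v11.4 TEXT VERBATIM) ⟸ [Balaban1985Variational] THM 1 (8) AT EVERY ODD BLOCK SIZE — NO GAP♯∘** (supersedes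
✓`windowExactness_of_gapOrbit_thm1`, whose first hypothesis is deleted; block sizes carrying no `T3Family` are served vacuously). [cite: Balaban1985Variational, Thm 1 (8) p.279, Prop. 7 p.299] -/
theorem windowExactness_of_thm1
    (hT : ∀ L : ℕ, Odd L → 1 < L → ∃ a₀ a₁ B₃ : ℝ, 0 < a₀ ∧ 0 < a₁ ∧ 0 < B₃ ∧ Thm1GlobalMinAt L a₀ a₁ B₃) :
    ∀ (L : ℕ), ∃ c₀ : ℝ, 0 < c₀ ∧ c₀ ≤ 1 ∧ ∀ (cw : ℝ), 0 < cw → cw ≤ c₀ → ∃ pS : ℝ, ∀ (b₀ p₀ : ℝ), 0 < b₀ → pS ≤ p₀ → 0 < p₀ → ∃ ε₁ : ℝ, 0 < ε₁ ∧ ∀ (ε₀ : ℝ), 0 < ε₀ → ε₀ ≤ ε₁ →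
    ∃ γ₁ : ℝ, 0 < γ₁ ∧ ∀ (F : T3Family) (γ : ℝ), F.L = L → 0 < γ → γ ≤ γ₁ →
      ∀ (J K : ℕ) (hJK : J ≤ K) (V : GaugeField (F.P J) 0 (Matrix.specialUnitaryGroup (Fin 2) ℂ)), PlaqSmall (θBal F.L γ (cw * b₀) p₀ J) V →
        (∀ U ∈ fibre F ℰp J K hJK V, U ∈ histGood F ℰp (θBal F.L γ b₀ p₀) K J →
            minActionRegPr F J K hJK ε₀ V ≤ wilsonAction4 U) ∧
        (∃ U₀ ∈ regFibrePr F J K hJK ε₀ V, U₀ ∈ histGood F ℰp (θBal F.L γ b₀ p₀) K J ∧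
            wilsonAction4 U₀ = minActionRegPr F J K hJK ε₀ V) := by
  intro L
  by_cases hLodd : Odd L ∧ 1 < L
  · obtain ⟨a₀, a₁, B₃, ha₀, ha₁, hB₃, hT1⟩ := hT L hLodd.1 hLodd.2
    exact windowExactness_at hLodd.2 ha₀ ha₁ hB₃ hT1
  · refine ⟨1, one_pos, le_rfl, fun cw _ _ => ⟨0, fun b₀ p₀ _ _ _ => ⟨1, one_pos, fun ε₀ _ _ => ⟨1, one_pos, ?_⟩⟩⟩⟩
    intro F γ hFL
    exact absurd (hFL ▸ F.hL) hLodd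

/-- ★★★★★ **THE REGISTERED STUB `stub_windowExactness` REDUCED TO THM 1 (8) AT `L = 3` ALONE**: EXW∘'s v11.4 text from `∃ a₀ a₁ B₃ > 0, Thm1GlobalMinAt 3 a₀ a₁ B₃` (every
`L ≥ 5` by ✓`thm1GlobalMinAt_five`, ✓`thm1_allL_of_three`; `L = 3` = the [Balaban1985RegularSpaces] Thm-2 socket, EMBARGO-LITE №58). [cite: Balaban1985Variational, Thm 1 (8) p.279; Balaban1985RegularSpaces, Thm 2 p.83] -/
theorem windowExactness_of_thm1AtThree (hT₃ : ∃ a₀ a₁ B₃ : ℝ, 0 < a₀ ∧ 0 < a₁ ∧ 0 < B₃ ∧ Thm1GlobalMinAt 3 a₀ a₁ B₃) :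
    ∀ (L : ℕ), ∃ c₀ : ℝ, 0 < c₀ ∧ c₀ ≤ 1 ∧ ∀ (cw : ℝ), 0 < cw → cw ≤ c₀ → ∃ pS : ℝ, ∀ (b₀ p₀ : ℝ), 0 < b₀ → pS ≤ p₀ → 0 < p₀ → ∃ ε₁ : ℝ, 0 < ε₁ ∧ ∀ (ε₀ : ℝ), 0 < ε₀ → ε₀ ≤ ε₁ →
    ∃ γ₁ : ℝ, 0 < γ₁ ∧ ∀ (F : T3Family) (γ : ℝ), F.L = L → 0 < γ → γ ≤ γ₁ →
      ∀ (J K : ℕ) (hJK : J ≤ K) (V : GaugeField (F.P J) 0 (Matrix.specialUnitaryGroup (Fin 2) ℂ)), PlaqSmall (θBal F.L γ (cw * b₀) p₀ J) V →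
        (∀ U ∈ fibre F ℰp J K hJK V, U ∈ histGood F ℰp (θBal F.L γ b₀ p₀) K J →
            minActionRegPr F J K hJK ε₀ V ≤ wilsonAction4 U) ∧
        (∃ U₀ ∈ regFibrePr F J K hJK ε₀ V, U₀ ∈ histGood F ℰp (θBal F.L γ b₀ p₀) K J ∧
            wilsonAction4 U₀ = minActionRegPr F J K hJK ε₀ V) :=
  windowExactness_of_thm1 (thm1_allL_of_three hT₃)

/-- ★★★★★ **EXW∘'s BODY AT EVERY BLOCK SIZE `L ≥ 5` — ZERO HYPOTHESES** (✓`thm1GlobalMinAt_five` ∘ `windowExactness_at`): for the `SU(2)` d = 3 torus family, on the interior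
window, the minimum of the Wilson action over print's regular space (6)(ε₀) is below the action of every good history AND is attained at a regular good history.
[cite: Balaban1985Variational, Thm 1 (8) p.279, Prop. 7 p.299, Prop. 8 p.304; Balaban1985UV3, (7) p.257, (41) p.266] -/
theorem windowExactness_body_five (L : ℕ) (h5 : 5 ≤ L) : ∃ c₀ : ℝ, 0 < c₀ ∧ c₀ ≤ 1 ∧ ∀ (cw : ℝ), 0 < cw → cw ≤ c₀ → ∃ pS : ℝ, ∀ (b₀ p₀ : ℝ), 0 < b₀ → pS ≤ p₀ → 0 < p₀ → ∃ ε₁ : ℝ, 0 < ε₁ ∧ ∀ (ε₀ : ℝ), 0 < ε₀ → ε₀ ≤ ε₁ →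
    ∃ γ₁ : ℝ, 0 < γ₁ ∧ ∀ (F : T3Family) (γ : ℝ), F.L = L → 0 < γ → γ ≤ γ₁ →
      ∀ (J K : ℕ) (hJK : J ≤ K) (V : GaugeField (F.P J) 0 (Matrix.specialUnitaryGroup (Fin 2) ℂ)), PlaqSmall (θBal F.L γ (cw * b₀) p₀ J) V →
        (∀ U ∈ fibre F ℰp J K hJK V, U ∈ histGood F ℰp (θBal F.L γ b₀ p₀) K J →
            minActionRegPr F J K hJK ε₀ V ≤ wilsonAction4 U) ∧
        (∃ U₀ ∈ regFibrePr F J K hJK ε₀ V, U₀ ∈ histGood F ℰp (θBal F.L γ b₀ p₀) K J ∧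
            wilsonAction4 U₀ = minActionRegPr F J K hJK ε₀ V) := by
  obtain ⟨a₀, a₁, B₃, ha₀, ha₁, hB₃, hT1⟩ := thm1GlobalMinAt_five L h5
  exact windowExactness_at (by omega) ha₀ ha₁ hB₃ hT1

end Door

end Summit.QuantumFields.YangMills.Theorems.FluctuationComparisonRegPrIntLS2BetaWindowExactnessOfTower
end
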